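import Summits.QuantumFields.BalabanUV.Beta.GAN24.BornLambdaBracketLetter
import Summits.QuantumFields.BalabanUV.Beta.GAN24.CombContactCellLetters

/-!
# `BalabanUV.Beta.GAN24.CombBornLambdaGaugeBlind` — binder row G-an2-4 ∕ (CONV-C), TRANSFER-III, the (III′) S-slot (b) of the END, born-Λ contact letters `hCg ∕ hPc`
# (road-P2 M.104's 3rd∕4th hypotheses): **THE BORN-Λ BRACKET AND THE VERTEX TENT ARE BLIND TO THE CONJUGATION** — gan24-p2 g33's bracket letters
# (`BornLambdaBracketLetter.exists_bracket_bornLam_zero∕succ_letter_three`) and leaf-01 g59's vertex tent (`BornLambdaVertexTent.tsum_wΦ_shift_mul_legChain_eq_tent`)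
# hold VERBATIM, with the SAME constants, for the CONJUGATED (comb-chart) legs `T′ = legChain (j ↦ legComp ψ♭_r (respStepBmSeq ρ Lc j))` in place of the dressed legs
# `T = legChain (respStepBmSeq ρ Lc)` — an OWNER-side WORD for leaf-01 g89's sizing `S-SLOT-LETTERS-SIZING-g89.md` §2 (G-an2-4 ∕ (CONV-C) OWNER `b2b-balaban-gan24-p1`,
# gen 54, author of `CombLegChainGauge`; journal [GAN24P1-G54-INTENT-4])

WHY (no table involved).  The born-Λ coefficient families are CO-EXACT in the leg's output slot — `a·𝒬ᵀ_{Lc}[wΦ-column]` (`bornCoeff_zero_eq_tent ∕ bornCoeff_succ_eq_tent`) — and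
`T′ − T = dz ∘ PsiFace` there (road-P2 M.59 `CombContactKernelCells.combLegChain_sub_legChain`, the kernel form of MY `legAct_legChain_psiLeg_eq`).  A pure gauge paired with a
co-exact 1-form vanishes by summation by parts (`KKTFluctuationEnergy.lip0_codiff₁`) because `codiff₁ ∘ 𝒬ᵀ_{Lc} = codiff₁ ∘ quo` (`ResolventComposition.codiff₁_contourSumAdj`) and the
multiplier column is co-closed (`ValueHessianBlind`'s `codiff₁_wΦ_shift`); in the vertex slot the multiplier column kills the face gauge directly (`BornLambdaVertexTent.tsum_wΦ_shift_mul_dz_eq_zero`).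
The only qualitative input is that `PsiFace r ρ Lc m k (delta1 μ z)` is BOUNDED (it is summable: MY `CombLegChainGauge.summable_PsiFace`).

WHAT IS PROVED (generic `d`, roots `r rr ∈ box (d+1) Lc`, unless marked `d = 3`):
* §1 `exists_abs_PsiFace_delta1_le` — the face gauge of the point datum is bounded.
* §2 `tsum_sum_dz_mul_contourSumAdj_wΦ_eq_zero` — `Σ'_u Σ_κ dz ψ κ u · 𝒬ᵀ_{Lc}[κ″ q ↦ wΦ_N κ″ μ (q − y)] κ u = 0` for bounded `ψ`.
* §3 `tsum_sum_combLegChain_mul_tentCoeff_eq` — `⟨T′ m n (κ′u′; ·), a·(b·𝒬ᵀ_{Lc}[wΦ-column])⟩ = ⟨T m n (κ′u′; ·), same⟩`.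
* §4 (`d = 3`, `2 ≤ Lc`) `exists_bracket_bornLam_zero_letter_comb_three ∕ exists_bracket_bornLam_succ_letter_comb_three` — gan24-p2's two (C2) letters with `T ↦ T′`, the member-`0` ∕
  member-`(j+1)` born-Λ coefficients LITERALLY, `∀ r rr ∈ box` inside the `∃ C δ` (the (E) pair `(C, δ)`).
* §5 `tsum_wΦ_shift_mul_combLegChain_eq_tent` (generic `d`, under leaf-01's `hψ`) ∕ `…_three` (`d = 3`, `2 ≤ Lc`, no hypothesis) — the vertex factor of the conjugated chain from
  level `i+1` IS the `Lc^{n+1}`-contour tent of the level-`(i+n+2)` multiplier column, exactly as for the dressed chain.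
NOT HERE: the sym-table side of `hCg ∕ hPc` (the `SLam`-on-`symHessFFAt` cells, `hdiv`, the cubic push `BornLambdaContactCells` at `combFreshAt`, the count) — leaf-01's ∕ road-P2's lane.

NOT IN PRINT; OUR BOOKKEEPING ([folklore] summation by parts over landed identities; 0 `def`, 0 cited fact, 0 `def … : Prop`, 0 sorry).  HONEST FRAMING (cell contract,
verbatim): «discharging `BetaPertH` makes Bałaban's UV stability UNCONDITIONAL — a real constructive-QFT result; it is NOT the continuum limit and NOT the Clay problem.»
HONEST DEPENDENCY (verbatim): «continuum YM on T⁴ ⇐ BetaPertH ∧ nine spine estimates (0/9 proved); BetaPertH ⇐ (D1) ∧ (D4) ∧ CAP+tail; G-an2-4 gates asym, D1 and NE2/3/4.»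
Discharges NO letter of M.104 by itself; NEVER «G-an2-4 closed» as (CONV-C); NOT D1, NOT `BetaPertH`, NOT continuum, NOT Clay.  2026-08-28; no existing file touched.
-/

noncomputable section

open Finset
open scoped BigOperators
open Literature.MathematicalPhysics.QuantumFieldTheory
open Literature.MathematicalPhysics.QuantumFieldTheory.LatticeForm (quo)
open Literature.MathematicalPhysics.QuantumFieldTheory.Balaban1983to89
open Literature.MathematicalPhysics.QuantumFieldTheory.Balaban1983to89.Beta
open B4ContourShift (supNorm)
open AffineAveraging (Form0 Form1 Site box toSite dz)
open AffineReproduction (contourSumAdj)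
open KernelSpecInstance (wΦ)
open KKTFluctuationKernel (delta1)
open KKTFluctuationEnergy (lip0 lip1 lip0_codiff₁ summable_dz summable_mul_of_bdd summable_mul_of_bdd' abs_dz_le summable_shift_sub contourSumAdj_eq)
open OneStepResolventKernel (Fib KInv)
open BalabanStepJetsSucc (E2 lamCoeffK)
open BalabanStepJets (lamCoeffOf)
open BalabanCompositeJets (respStep)
open ResolventComposition (codiff₁_contourSumAdj)
open Summit.QuantumFields.BalabanUV.Beta.AxialProjectorBlockMean (bmGaugeAt)
open Summit.QuantumFields.BalabanUV.Beta.SymCorrectorKernel (psiKS)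
open Summit.QuantumFields.BalabanUV.Beta.BorderedHessian (codiff₁_wΦ_shift)
open Summit.QuantumFields.BalabanUV.Beta.GAN24.CombesThomas (smStep KStepUnit)
open Summit.QuantumFields.BalabanUV.Beta.GAN24.Push4 (legComp)
open Summit.QuantumFields.BalabanUV.Beta.GAN24.Push4Iter (legChain)
open Summit.QuantumFields.BalabanUV.Beta.GAN24.RespStepBmDecompExact (respStepBmSeq)
open Summit.QuantumFields.BalabanUV.Beta.GAN24.RespStepBmDecompPsi (Psi)
open Summit.QuantumFields.BalabanUV.Beta.GAN24.TaylorBlockSum (summable_comp_quo)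
open Summit.QuantumFields.BalabanUV.Beta.GAN24.ContactKernelCells (summable_delta1)
open Summit.QuantumFields.BalabanUV.Beta.GAN24.CombLegChainGauge (PsiFace summable_PsiFace)
open Summit.QuantumFields.BalabanUV.Beta.GAN24.CombContactKernelCells (combLegChain_sub_legChain)
open Summit.QuantumFields.BalabanUV.Beta.GAN24.CombContactCellLetters (summable_combLegChain)
open Summit.QuantumFields.BalabanUV.Beta.GAN24.BornLambdaVertexTent (summable_wΦ_shift tsum_wΦ_shift_mul_dz_eq_zero tsum_wΦ_shift_mul_legChain_eq_tent
  tsum_wΦ_shift_mul_legChain_eq_tent_three)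
open Summit.QuantumFields.BalabanUV.Beta.GAN24.BornLambdaBracketLetter (tsum_sum_mul_const_mul exists_abs_wΦ_le bornCoeff_zero_eq_tent bornCoeff_succ_eq_tent
  exists_bracket_bornLam_zero_letter_three exists_bracket_bornLam_succ_letter_three)
open Summit.QuantumFields.BalabanUV.Beta.GAN24.BornLambdaContactCells (exists_abs_lineageGauge_le)

namespace Summit.QuantumFields.BalabanUV.Beta.GAN24.CombBornLambdaGaugeBlind

variable {d : ℕ} {Lc : ℕ} [NeZero Lc]

/-! ## §1 The face gauge of the point datum is bounded -/

section Bounded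

variable {r : Fin (d + 1) → ℕ} (hr : r ∈ box (d + 1) Lc) {rr : Fin (d + 1) → ℕ} (hrr : rr ∈ box (d + 1) Lc)
include hr hrr

/-- [folklore] **`PsiFace r ρ Lc m k (delta1 μ z)` IS BOUNDED** — it is summable (MY `summable_PsiFace` at the summable point datum), hence bounded by its own `ℓ¹` norm. -/
theorem exists_abs_PsiFace_delta1_le (m k : ℕ) (μ : Fin (d + 1)) (z : Site (d + 1)) :
    ∃ M : ℝ, ∀ x, |PsiFace r (toSite rr) Lc m k (delta1 μ z) x| ≤ M := by
  have hs : Summable (PsiFace r (toSite rr) Lc m k (delta1 μ z)) := summable_PsiFace hr hrr k m (summable_delta1 μ z)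
  have ha : Summable fun x => |PsiFace r (toSite rr) Lc m k (delta1 μ z) x| := hs.abs
  exact ⟨∑' x, |PsiFace r (toSite rr) Lc m k (delta1 μ z) x|, fun x => ha.le_tsum x (fun y _ => abs_nonneg _)⟩

end Bounded

/-! ## §2 A pure gauge paired with the co-exact multiplier coefficient vanishes -/

section Coexact

omit [NeZero Lc] in
/-- [folklore] The contour-adjoint of the (summable) multiplier column is summable in the site, component by component (`summable_comp_quo` ∘ `summable_wΦ_shift`, `L` shifts). -/
theorem summable_contourSumAdj_wΦ_shift {L : ℕ} [NeZero L] {N : ℕ} [NeZero N] (μ : Fin (d + 1)) (y : Site (d + 1)) (κ : Fin (d + 1)) :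
    Summable fun u : Site (d + 1) => contourSumAdj L (fun κ'' q => wΦ (N := N) (d := d) κ'' μ (q - y)) κ u := by
  have e : (fun u : Site (d + 1) => contourSumAdj L (fun κ'' q => wΦ (N := N) (d := d) κ'' μ (q - y)) κ u)
      = fun u => ∑ s ∈ Finset.range L, wΦ (N := N) (d := d) κ μ (quo L (u - (s : ℤ) • AffineAveraging.unitVec κ) - y) := by
    funext u; rw [contourSumAdj_eq]
  rw [e]
  refine summable_sum fun s _ => ?_
  have h1 : Summable fun w : Site (d + 1) => wΦ (N := N) (d := d) κ μ (quo L w - y) :=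
    summable_comp_quo (N := L) (g := fun y₁ : Site (d + 1) => wΦ (N := N) (d := d) κ μ (y₁ - y)) (summable_wΦ_shift μ y κ)
  exact summable_shift_sub h1 _

omit [NeZero Lc] in
/-- [folklore] **`⟨dz ψ, 𝒬ᵀ_{L}[wΦ-column]⟩ = 0` FOR BOUNDED `ψ`**: summation by parts (`lip0_codiff₁`) onto `codiff₁ (𝒬ᵀ_L φ) x = codiff₁ φ (quo L x)` (`codiff₁_contourSumAdj`)
and the column's co-closedness (`codiff₁_wΦ_shift`). -/
theorem tsum_sum_dz_mul_contourSumAdj_wΦ_eq_zero {L : ℕ} [NeZero L] {N : ℕ} [NeZero N] {ψ : Form0 (d + 1) ℝ} {M : ℝ} (hψ : ∀ x, |ψ x| ≤ M)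
    (μ : Fin (d + 1)) (y : Site (d + 1)) :
    ∑' u : Site (d + 1), ∑ κ : Fin (d + 1), dz ψ κ u * contourSumAdj L (fun κ'' q => wΦ (N := N) (d := d) κ'' μ (q - y)) κ u = 0 := by
  have h := lip0_codiff₁ (f := ψ) (B := contourSumAdj L (fun κ'' q => wΦ (N := N) (d := d) κ'' μ (q - y))) hψ
    (fun κ => summable_contourSumAdj_wΦ_shift (d := d) μ y κ)
  have h0 : AffineAveraging.codiff₁ (contourSumAdj L (fun κ'' q => wΦ (N := N) (d := d) κ'' μ (q - y))) = 0 := by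
    funext x
    have hc := codiff₁_contourSumAdj (N := L) (fun κ'' q => wΦ (N := N) (d := d) κ'' μ (q - y)) x
    rw [codiff₁_wΦ_shift (N := N) μ y] at hc
    exact hc
  rw [h0] at h
  have hz : lip0 ψ (0 : Form0 (d + 1) ℝ) = 0 := by simp [lip0]
  rw [hz] at h
  exact h.symm

end Coexact

/-! ## §3 The bracket of the conjugated chain against a tent coefficient equals the dressed chain's -/

section Bracket

variable {r : Fin (d + 1) → ℕ} (hr : r ∈ box (d + 1) Lc) {rr : Fin (d + 1) → ℕ} (hrr : rr ∈ box (d + 1) Lc)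
include hr hrr

/-- NOT IN PRINT; OUR BOOKKEEPING.  **THE BRACKET IS BLIND TO THE CONJUGATION**: for every tent coefficient `c κ u = a·(b·𝒬ᵀ_{Lc}[κ″ q ↦ wΦ_N κ″ μ (q − y)] κ u)`,
`Σ'_u Σ_κ T′ m n κ′ u′ κ u · c κ u = Σ'_u Σ_κ T m n κ′ u′ κ u · c κ u` — `T′ − T = dz (PsiFace … (delta1 κ′ u′))` in the output slot (M.59) and §2. -/
theorem tsum_sum_combLegChain_mul_tentCoeff_eq {N : ℕ} [NeZero N] (m n : ℕ) (κ' : Fin (d + 1)) (u' : Site (d + 1)) (a b : ℝ)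
    (μ : Fin (d + 1)) (y : Site (d + 1)) :
    ∑' u, ∑ κ, legChain (fun j => legComp (fun α x κ u => psiKS r Lc u x (Sum.inl κ) (Sum.inl α)) (respStepBmSeq (d := d) (toSite rr) Lc j)) m n κ' u' κ u *
        (a * (b * contourSumAdj Lc (fun κ'' q => wΦ (N := N) (d := d) κ'' μ (q - y)) κ u))
      = ∑' u, ∑ κ, legChain (respStepBmSeq (d := d) (toSite rr) Lc) m n κ' u' κ u *
        (a * (b * contourSumAdj Lc (fun κ'' q => wΦ (N := N) (d := d) κ'' μ (q - y)) κ u)) := by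
  set ψ : Form0 (d + 1) ℝ := PsiFace r (toSite rr) Lc m n (delta1 κ' u') with hψdef
  set W : Fin (d + 1) → Site (d + 1) → ℝ := fun κ u => contourSumAdj Lc (fun κ'' q => wΦ (N := N) (d := d) κ'' μ (q - y)) κ u with hWdef
  obtain ⟨M, hM⟩ := exists_abs_PsiFace_delta1_le (d := d) hr hrr m n κ' u'
  -- the split of the conjugated chain: dressed chain + pure gauge, entrywise
  have hsub := combLegChain_sub_legChain (d := d) hr hrr m n
  have e : ∀ u κ, legChain (fun j => legComp (fun α x κ u => psiKS r Lc u x (Sum.inl κ) (Sum.inl α)) (respStepBmSeq (d := d) (toSite rr) Lc j)) m n κ' u' κ u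
      = legChain (respStepBmSeq (d := d) (toSite rr) Lc) m n κ' u' κ u + dz ψ κ u := by
    intro u κ
    have h := congrFun (congrFun (congrFun (congrFun hsub κ') u') κ) u
    simp only [Pi.sub_apply] at h
    rw [hψdef]
    linarith
  -- a bound on the tent coefficient and the two summabilities
  obtain ⟨B, hB⟩ := exists_abs_wΦ_le (d := d) N
  have hWb : ∀ κ u, |W κ u| ≤ (Lc : ℝ) * B := fun κ u =>
    KKTFluctuationEnergy.abs_contourSumAdj_le (N := Lc) (fun κ₁ q => hB κ₁ μ (q - y)) κ u
  have hc : ∀ κ u, |a * (b * W κ u)| ≤ |a| * (|b| * ((Lc : ℝ) * B)) := by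
    intro κ u
    rw [abs_mul, abs_mul]
    exact mul_le_mul_of_nonneg_left (mul_le_mul_of_nonneg_left (hWb κ u) (abs_nonneg _)) (abs_nonneg _)
  have s1 : Summable fun u : Site (d + 1) => ∑ κ : Fin (d + 1),
      legChain (fun j => legComp (fun α x κ u => psiKS r Lc u x (Sum.inl κ) (Sum.inl α)) (respStepBmSeq (d := d) (toSite rr) Lc j)) m n κ' u' κ u * (a * (b * W κ u)) :=
    summable_sum fun κ _ => summable_mul_of_bdd' (summable_combLegChain hr hrr m n κ' u' κ) (fun u => hc κ u)
  have s2 : Summable fun u : Site (d + 1) => ∑ κ : Fin (d + 1), dz ψ κ u * (a * (b * W κ u)) :=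
    summable_sum fun κ _ => summable_mul_of_bdd (fun u => abs_dz_le hM κ u)
      (((summable_contourSumAdj_wΦ_shift (d := d) (L := Lc) (N := N) μ y κ).mul_left b).mul_left a)
  -- the gauge part pairs to zero
  have hz : ∑' u : Site (d + 1), ∑ κ : Fin (d + 1), dz ψ κ u * (a * (b * W κ u)) = 0 := by
    rw [tsum_sum_mul_const_mul (fun κ u => dz ψ κ u) (fun κ u => b * W κ u) a,
      tsum_sum_mul_const_mul (fun κ u => dz ψ κ u) W b, hWdef, tsum_sum_dz_mul_contourSumAdj_wΦ_eq_zero hM μ y, mul_zero, mul_zero]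
  -- assemble: T·c = T′·c − dzψ·c pointwise
  have e' : ∀ u, (∑ κ, legChain (respStepBmSeq (d := d) (toSite rr) Lc) m n κ' u' κ u * (a * (b * W κ u)))
      = (∑ κ, legChain (fun j => legComp (fun α x κ u => psiKS r Lc u x (Sum.inl κ) (Sum.inl α)) (respStepBmSeq (d := d) (toSite rr) Lc j)) m n κ' u' κ u * (a * (b * W κ u)))
        - ∑ κ, dz ψ κ u * (a * (b * W κ u)) := by
    intro u
    rw [← Finset.sum_sub_distrib]
    exact Finset.sum_congr rfl fun κ _ => by rw [e u κ]; ring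
  show ∑' u, ∑ κ, _ * (a * (b * W κ u)) = ∑' u, ∑ κ, _ * (a * (b * W κ u))
  rw [show (fun u => ∑ κ, legChain (respStepBmSeq (d := d) (toSite rr) Lc) m n κ' u' κ u * (a * (b * W κ u)))
      = fun u => (∑ κ, legChain (fun j => legComp (fun α x κ u => psiKS r Lc u x (Sum.inl κ) (Sum.inl α)) (respStepBmSeq (d := d) (toSite rr) Lc j)) m n κ' u' κ u
          * (a * (b * W κ u))) - ∑ κ, dz ψ κ u * (a * (b * W κ u)) from funext e', Summable.tsum_sub s1 s2, hz, sub_zero]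

end Bracket

/-! ## §4 `d = 3`: gan24-p2's two (C2) bracket letters for the conjugated legs, same constants -/

section Letters

variable {Lc : ℕ} [NeZero Lc]

/-- NOT IN PRINT; OUR BOOKKEEPING.  **THE (C2) LETTER ON THE MEMBER-`0` CELLS, CONJUGATED LEGS** (`d = 3`, `2 ≤ Lc`; the pair `(C, δ)` of gan24-p2's
`exists_bracket_bornLam_zero_letter_three`, for ALL roots `r rr ∈ box`): `|Σ'_u Σ_κ T′_{r,rr} 0 (k−1−0) κ′ u′ κ u · (cΛ·lamCoeffOf (KInv Lc) Lc μ y κ u)| ≤ |cΛ|·C·((Lc^{k−1})^7)⁻¹·e^{−δ‖quo (Lc^{k−1}) y − u′‖∞}`. -/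
theorem exists_bracket_bornLam_zero_letter_comb_three (hLc : 2 ≤ Lc) :
    ∃ C δ : ℝ, 0 ≤ C ∧ 0 < δ ∧ ∀ (r : Fin (3 + 1) → ℕ), r ∈ box (3 + 1) Lc → ∀ (rr : Fin (3 + 1) → ℕ), rr ∈ box (3 + 1) Lc → ∀ (cΛ : ℝ) (k : ℕ),
      ∀ (κ' : Fin (3 + 1)) (u' : Site (3 + 1)) (μ : Fin (3 + 1)) (y : Site (3 + 1)),
        |∑' u, ∑ κ, legChain (fun j => legComp (fun α x κ u => psiKS r Lc u x (Sum.inl κ) (Sum.inl α)) (respStepBmSeq (d := 3) (toSite rr) Lc j)) 0 (k - 1 - 0) κ' u' κ u *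
            (cΛ * lamCoeffOf (KInv (N := Lc) (d := 3)) Lc μ y κ u)|
          ≤ |cΛ| * C * ((((Lc : ℝ) ^ (k - 1 - 0)) ^ (2 * 3 + 1))⁻¹) * Real.exp (-(δ * supNorm (quo (Lc ^ (k - 1 - 0)) y - u'))) := by
  obtain ⟨C, δ, hC, hδ, h⟩ := exists_bracket_bornLam_zero_letter_three (Lc := Lc) hLc
  refine ⟨C, δ, hC, hδ, fun r hr rr hrr cΛ k κ' u' μ y => ?_⟩
  have e : (fun u => ∑ κ, legChain (fun j => legComp (fun α x κ u => psiKS r Lc u x (Sum.inl κ) (Sum.inl α)) (respStepBmSeq (d := 3) (toSite rr) Lc j)) 0 (k - 1 - 0) κ' u' κ u *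
        (cΛ * lamCoeffOf (KInv (N := Lc) (d := 3)) Lc μ y κ u))
      = fun u => ∑ κ, legChain (fun j => legComp (fun α x κ u => psiKS r Lc u x (Sum.inl κ) (Sum.inl α)) (respStepBmSeq (d := 3) (toSite rr) Lc j)) 0 (k - 1 - 0) κ' u' κ u *
        ((-cΛ) * ((((Lc : ℝ) ^ 0) ^ (2 * (3 + 1))) *
          contourSumAdj Lc (fun κ'' q => wΦ (N := Lc ^ (0 + 1)) (d := 3) κ'' μ (q - y)) κ u)) := by
    funext u
    exact Finset.sum_congr rfl fun κ _ => by rw [bornCoeff_zero_eq_tent]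
  have e' : (fun u => ∑ κ, legChain (respStepBmSeq (d := 3) (toSite rr) Lc) 0 (k - 1 - 0) κ' u' κ u *
        (cΛ * lamCoeffOf (KInv (N := Lc) (d := 3)) Lc μ y κ u))
      = fun u => ∑ κ, legChain (respStepBmSeq (d := 3) (toSite rr) Lc) 0 (k - 1 - 0) κ' u' κ u *
        ((-cΛ) * ((((Lc : ℝ) ^ 0) ^ (2 * (3 + 1))) *
          contourSumAdj Lc (fun κ'' q => wΦ (N := Lc ^ (0 + 1)) (d := 3) κ'' μ (q - y)) κ u)) := by
    funext u
    exact Finset.sum_congr rfl fun κ _ => by rw [bornCoeff_zero_eq_tent]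
  have hb := h rr hrr cΛ k κ' u' μ y
  rw [show (∑' u, ∑ κ, legChain (respStepBmSeq (d := 3) (toSite rr) Lc) 0 (k - 1 - 0) κ' u' κ u * (cΛ * lamCoeffOf (KInv (N := Lc) (d := 3)) Lc μ y κ u))
      = ∑' u, (fun u => ∑ κ, legChain (respStepBmSeq (d := 3) (toSite rr) Lc) 0 (k - 1 - 0) κ' u' κ u * (cΛ * lamCoeffOf (KInv (N := Lc) (d := 3)) Lc μ y κ u)) u
      from rfl, e', ← tsum_sum_combLegChain_mul_tentCoeff_eq (d := 3) hr hrr 0 (k - 1 - 0) κ' u' (-cΛ) (((Lc : ℝ) ^ 0) ^ (2 * (3 + 1))) μ y] at hb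
  rw [show (∑' u, ∑ κ, legChain (fun j => legComp (fun α x κ u => psiKS r Lc u x (Sum.inl κ) (Sum.inl α)) (respStepBmSeq (d := 3) (toSite rr) Lc j)) 0 (k - 1 - 0) κ' u' κ u *
        (cΛ * lamCoeffOf (KInv (N := Lc) (d := 3)) Lc μ y κ u))
      = ∑' u, (fun u => ∑ κ, legChain (fun j => legComp (fun α x κ u => psiKS r Lc u x (Sum.inl κ) (Sum.inl α)) (respStepBmSeq (d := 3) (toSite rr) Lc j)) 0 (k - 1 - 0) κ' u' κ u *
        (cΛ * lamCoeffOf (KInv (N := Lc) (d := 3)) Lc μ y κ u)) u from rfl, e]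
  exact hb

/-- NOT IN PRINT; OUR BOOKKEEPING.  **THE (C2) LETTER ON THE MEMBER-`(j+1)` CELLS, CONJUGATED LEGS** (`d = 3`, `2 ≤ Lc`; the pair `(C, δ)` of gan24-p2's
`exists_bracket_bornLam_succ_letter_three`, ALL roots): coefficient `(cΛ·Lc⁸)·lamCoeffK (KStepUnit Lc (j+1)) ((smStep 3 Lc j)²•E2 3 Lc (j+1)) Lc` LITERALLY. -/
theorem exists_bracket_bornLam_succ_letter_comb_three (hLc : 2 ≤ Lc) :
    ∃ C δ : ℝ, 0 ≤ C ∧ 0 < δ ∧ ∀ (r : Fin (3 + 1) → ℕ), r ∈ box (3 + 1) Lc → ∀ (rr : Fin (3 + 1) → ℕ), rr ∈ box (3 + 1) Lc → ∀ (cΛ : ℝ) (j k : ℕ),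
      ∀ (κ' : Fin (3 + 1)) (u' : Site (3 + 1)) (μ : Fin (3 + 1)) (y : Site (3 + 1)),
        |∑' u, ∑ κ, legChain (fun j => legComp (fun α x κ u => psiKS r Lc u x (Sum.inl κ) (Sum.inl α)) (respStepBmSeq (d := 3) (toSite rr) Lc j)) (j + 1) (k - 1 - (j + 1)) κ' u' κ u *
            ((cΛ * (Lc : ℝ) ^ (2 * (3 + 1))) *
              lamCoeffK (KStepUnit (d := 3) Lc (j + 1)) ((smStep 3 Lc j) ^ 2 • E2 3 Lc (j + 1)) Lc μ y κ u)|
          ≤ |cΛ| * C * ((((Lc : ℝ) ^ (k - 1 - (j + 1))) ^ (2 * 3 + 1))⁻¹) *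
            Real.exp (-(δ * supNorm (quo (Lc ^ (k - 1 - (j + 1))) y - u'))) := by
  obtain ⟨C, δ, hC, hδ, h⟩ := exists_bracket_bornLam_succ_letter_three (Lc := Lc) hLc
  refine ⟨C, δ, hC, hδ, fun r hr rr hrr cΛ j k κ' u' μ y => ?_⟩
  have e : (fun u => ∑ κ, legChain (fun j => legComp (fun α x κ u => psiKS r Lc u x (Sum.inl κ) (Sum.inl α)) (respStepBmSeq (d := 3) (toSite rr) Lc j)) (j + 1) (k - 1 - (j + 1)) κ' u' κ u *
        ((cΛ * (Lc : ℝ) ^ (2 * (3 + 1))) *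
          lamCoeffK (KStepUnit (d := 3) Lc (j + 1)) ((smStep 3 Lc j) ^ 2 • E2 3 Lc (j + 1)) Lc μ y κ u))
      = fun u => ∑ κ, legChain (fun j => legComp (fun α x κ u => psiKS r Lc u x (Sum.inl κ) (Sum.inl α)) (respStepBmSeq (d := 3) (toSite rr) Lc j)) (j + 1) (k - 1 - (j + 1)) κ' u' κ u *
        ((-cΛ) * ((((Lc : ℝ) ^ (j + 1)) ^ (2 * (3 + 1))) *
          contourSumAdj Lc (fun κ'' q => wΦ (N := Lc ^ (j + 1 + 1)) (d := 3) κ'' μ (q - y)) κ u)) := by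
    funext u
    exact Finset.sum_congr rfl fun κ _ => by rw [bornCoeff_succ_eq_tent]
  have e' : (fun u => ∑ κ, legChain (respStepBmSeq (d := 3) (toSite rr) Lc) (j + 1) (k - 1 - (j + 1)) κ' u' κ u *
        ((cΛ * (Lc : ℝ) ^ (2 * (3 + 1))) *
          lamCoeffK (KStepUnit (d := 3) Lc (j + 1)) ((smStep 3 Lc j) ^ 2 • E2 3 Lc (j + 1)) Lc μ y κ u))
      = fun u => ∑ κ, legChain (respStepBmSeq (d := 3) (toSite rr) Lc) (j + 1) (k - 1 - (j + 1)) κ' u' κ u *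
        ((-cΛ) * ((((Lc : ℝ) ^ (j + 1)) ^ (2 * (3 + 1))) *
          contourSumAdj Lc (fun κ'' q => wΦ (N := Lc ^ (j + 1 + 1)) (d := 3) κ'' μ (q - y)) κ u)) := by
    funext u
    exact Finset.sum_congr rfl fun κ _ => by rw [bornCoeff_succ_eq_tent]
  have hb := h rr hrr cΛ j k κ' u' μ y
  rw [show (∑' u, ∑ κ, legChain (respStepBmSeq (d := 3) (toSite rr) Lc) (j + 1) (k - 1 - (j + 1)) κ' u' κ u *
        ((cΛ * (Lc : ℝ) ^ (2 * (3 + 1))) * lamCoeffK (KStepUnit (d := 3) Lc (j + 1)) ((smStep 3 Lc j) ^ 2 • E2 3 Lc (j + 1)) Lc μ y κ u))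
      = ∑' u, (fun u => ∑ κ, legChain (respStepBmSeq (d := 3) (toSite rr) Lc) (j + 1) (k - 1 - (j + 1)) κ' u' κ u *
        ((cΛ * (Lc : ℝ) ^ (2 * (3 + 1))) * lamCoeffK (KStepUnit (d := 3) Lc (j + 1)) ((smStep 3 Lc j) ^ 2 • E2 3 Lc (j + 1)) Lc μ y κ u)) u
      from rfl, e', ← tsum_sum_combLegChain_mul_tentCoeff_eq (d := 3) hr hrr (j + 1) (k - 1 - (j + 1)) κ' u' (-cΛ) (((Lc : ℝ) ^ (j + 1)) ^ (2 * (3 + 1))) μ y] at hb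
  rw [show (∑' u, ∑ κ, legChain (fun j => legComp (fun α x κ u => psiKS r Lc u x (Sum.inl κ) (Sum.inl α)) (respStepBmSeq (d := 3) (toSite rr) Lc j)) (j + 1) (k - 1 - (j + 1)) κ' u' κ u *
        ((cΛ * (Lc : ℝ) ^ (2 * (3 + 1))) * lamCoeffK (KStepUnit (d := 3) Lc (j + 1)) ((smStep 3 Lc j) ^ 2 • E2 3 Lc (j + 1)) Lc μ y κ u))
      = ∑' u, (fun u => ∑ κ, legChain (fun j => legComp (fun α x κ u => psiKS r Lc u x (Sum.inl κ) (Sum.inl α)) (respStepBmSeq (d := 3) (toSite rr) Lc j)) (j + 1) (k - 1 - (j + 1)) κ' u' κ u *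
        ((cΛ * (Lc : ℝ) ^ (2 * (3 + 1))) * lamCoeffK (KStepUnit (d := 3) Lc (j + 1)) ((smStep 3 Lc j) ^ 2 • E2 3 Lc (j + 1)) Lc μ y κ u)) u from rfl, e]
  exact hb

end Letters

/-! ## §5 The vertex tent of the conjugated chain -/

section Tent

variable {r : Fin (d + 1) → ℕ} (hr : r ∈ box (d + 1) Lc) {rr : Fin (d + 1) → ℕ} (hrr : rr ∈ box (d + 1) Lc)
include hr hrr

/-- NOT IN PRINT; OUR BOOKKEEPING.  **THE VERTEX FACTOR OF THE CONJUGATED CHAIN IS THE E2-TENT** (generic `d`; under leaf-01's bound `hψ` on the (E) gauge): the level-(i+1)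
multiplier column paired with the CONJUGATED chain from level `i+1` is the `Lc^{n+1}`-contour tent of the level-`(i+n+2)` column — the face gauge drops out of the vertex slot
(`tsum_wΦ_shift_mul_dz_eq_zero`, §1) exactly as the inter-block gauge did (leaf-01's `tsum_wΦ_shift_mul_legChain_eq_tent`). -/
theorem tsum_wΦ_shift_mul_combLegChain_eq_tent (i n : ℕ) (μ : Fin (d + 1)) (y : Site (d + 1)) (κ' : Fin (d + 1)) (u' : Site (d + 1)) {M : ℝ}
    (hψ : ∀ x, |(Psi (toSite rr) Lc (i + 1) n (delta1 κ' u')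
        - bmGaugeAt (toSite rr) (respStep (d := d) (Lc ^ (i + 1)) (Lc ^ (i + n + 2)) κ' u') Lc) x| ≤ M) :
    ∑' y₁ : Site (d + 1), ∑ κ₁ : Fin (d + 1),
        wΦ (N := Lc ^ (i + 1)) (d := d) κ₁ μ (y₁ - y) *
          legChain (fun j => legComp (fun α x κ u => psiKS r Lc u x (Sum.inl κ) (Sum.inl α)) (respStepBmSeq (d := d) (toSite rr) Lc j)) (i + 1) n κ' u' κ₁ y₁
      = contourSumAdj (Lc ^ (n + 1)) (fun κ q => wΦ (N := Lc ^ (i + n + 2)) (d := d) κ κ' (q - u')) μ y := by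
  set φ : Form0 (d + 1) ℝ := PsiFace r (toSite rr) Lc (i + 1) n (delta1 κ' u') with hφdef
  obtain ⟨Mφ, hMφ⟩ := exists_abs_PsiFace_delta1_le (d := d) hr hrr (i + 1) n κ' u'
  obtain ⟨B, hB⟩ := exists_abs_wΦ_le (d := d) (Lc ^ (i + 1))
  have hsub := combLegChain_sub_legChain (d := d) hr hrr (i + 1) n
  have e : ∀ y₁ κ₁, legChain (fun j => legComp (fun α x κ u => psiKS r Lc u x (Sum.inl κ) (Sum.inl α)) (respStepBmSeq (d := d) (toSite rr) Lc j)) (i + 1) n κ' u' κ₁ y₁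
      = legChain (respStepBmSeq (d := d) (toSite rr) Lc) (i + 1) n κ' u' κ₁ y₁ + dz φ κ₁ y₁ := by
    intro y₁ κ₁
    have h := congrFun (congrFun (congrFun (congrFun hsub κ') u') κ₁) y₁
    simp only [Pi.sub_apply] at h
    rw [hφdef]
    linarith
  -- summability of the three products (bounded column × summable conjugated fibre; summable column × bounded gauge gradient; their difference)
  have hT' : ∀ κ₁ : Fin (d + 1), Summable fun y₁ : Site (d + 1) => wΦ (N := Lc ^ (i + 1)) (d := d) κ₁ μ (y₁ - y) *
      legChain (fun j => legComp (fun α x κ u => psiKS r Lc u x (Sum.inl κ) (Sum.inl α)) (respStepBmSeq (d := d) (toSite rr) Lc j)) (i + 1) n κ' u' κ₁ y₁ :=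
    fun κ₁ => summable_mul_of_bdd (fun y₁ => hB κ₁ μ (y₁ - y)) (summable_combLegChain hr hrr (i + 1) n κ' u' κ₁)
  have hG : ∀ κ₁ : Fin (d + 1), Summable fun y₁ : Site (d + 1) => wΦ (N := Lc ^ (i + 1)) (d := d) κ₁ μ (y₁ - y) * dz φ κ₁ y₁ :=
    fun κ₁ => summable_mul_of_bdd' (summable_wΦ_shift μ y κ₁) (fun y₁ => abs_dz_le hMφ κ₁ y₁)
  have hT : ∀ κ₁ : Fin (d + 1), Summable fun y₁ : Site (d + 1) => wΦ (N := Lc ^ (i + 1)) (d := d) κ₁ μ (y₁ - y) *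
      legChain (respStepBmSeq (d := d) (toSite rr) Lc) (i + 1) n κ' u' κ₁ y₁ :=
    fun κ₁ => ((hT' κ₁).sub (hG κ₁)).congr fun y₁ => by rw [e y₁ κ₁]; ring
  simp only [e, mul_add, Finset.sum_add_distrib]
  rw [Summable.tsum_add (summable_sum fun κ₁ _ => hT κ₁) (summable_sum fun κ₁ _ => hG κ₁), tsum_wΦ_shift_mul_dz_eq_zero μ y hMφ, add_zero]
  exact tsum_wΦ_shift_mul_legChain_eq_tent hrr i n μ y κ' u' hψ

end Tent

section TentThree

variable {Lc : ℕ} [NeZero Lc] {r : Fin (3 + 1) → ℕ} (hr : r ∈ box (3 + 1) Lc) {rr : Fin (3 + 1) → ℕ} (hrr : rr ∈ box (3 + 1) Lc)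
include hr hrr

/-- NOT IN PRINT; OUR BOOKKEEPING.  **`d = 3`, NO hypothesis on the gauge** (`2 ≤ Lc`, in-block roots): the vertex factor of the conjugated chain is the E2-tent —
leaf-01 g59's `BornLambdaContactCells.exists_abs_lineageGauge_le` discharges `hψ`, as in `tsum_wΦ_shift_mul_legChain_eq_tent_three`. -/
theorem tsum_wΦ_shift_mul_combLegChain_eq_tent_three (hLc : 2 ≤ Lc) (i n : ℕ) (μ : Fin (3 + 1)) (y : Site (3 + 1)) (κ' : Fin (3 + 1)) (u' : Site (3 + 1)) :
    ∑' y₁ : Site (3 + 1), ∑ κ₁ : Fin (3 + 1),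
        wΦ (N := Lc ^ (i + 1)) (d := 3) κ₁ μ (y₁ - y) *
          legChain (fun j => legComp (fun α x κ u => psiKS r Lc u x (Sum.inl κ) (Sum.inl α)) (respStepBmSeq (d := 3) (toSite rr) Lc j)) (i + 1) n κ' u' κ₁ y₁
      = contourSumAdj (Lc ^ (n + 1)) (fun κ q => wΦ (N := Lc ^ (i + n + 2)) (d := 3) κ κ' (q - u')) μ y := by
  obtain ⟨K, -, hK⟩ := exists_abs_lineageGauge_le (Lc := Lc) hLc
  have h := hK rr hrr (i + 1) n κ' u'
  rw [show i + 1 + n + 1 = i + n + 2 by ring] at h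
  exact tsum_wΦ_shift_mul_combLegChain_eq_tent hr hrr i n μ y κ' u' (M := K * ((Lc : ℝ) ^ (4 * (n + 1)))⁻¹) h

end TentThree

end Summit.QuantumFields.BalabanUV.Beta.GAN24.CombBornLambdaGaugeBlind

end
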